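import Mathlib
import HarnessLib
import Summits.HubbardSuperconductivity.HubbardSuperconductivity.Theorems.KLProgrammeKLRegimeSplitDefs

/-!
# Route `KLProgramme` — crux K3 `KLRegimeTwoPointLimit` (stmt-HubbardSuperconductivity-19937): the VOLUME-LIMIT text
# `FinalTwoLegVolLimit β U μ K Mstar` bound into the slot `VL` of the generic children `VolumeLimitP Pr VL W` (child 5) and
# `TwoPointAssemblyP3 Pr VL W` (child 4) of `KLProgrammeKLRegimeSplitGenericV3` (seat hubbard-kl-r2d-p2; plan g10 ruling
# «V5/V6», HOME/STATUS 2026-08-26T13:13:29Z / 13:16:09Z; Δ-asm (A) of 12:5xZ)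

WHY.  The four per-scale slots of `Preds` are (in)equalities at ONE volume `(L, M)`; the two-point thermodynamic limit of K3 needs,
in addition, the TERMWISE VOLUME LIMITS of the running blocks (BGM 2006 §2.4; «not a U-power series»: the truncated-bounds /
Vitali devices of the tree do not apply at real `U` in the KL regime), which only the engine's summable single-slice majorants can
supply.  Child 4 reads exactly ONE such limit: that of the two-leg vertex function (`klSelfEnergy`, the tree's `selfEnergy`) of the
FULLY INTEGRATED countertermed action `klEffectiveAction L M β U μ K klE0 (nScales β + 1)` (`klScale klE0 (nScales β + 1) < π/β`, so by
`hubbardEffectiveActionCT_eq_of_le` this is `effAction ℂ C^K V_K`), in the momentum representation: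

  `FinalTwoLegVolLimit β U μ K Mstar` := there are a limit function `Σ∞ : ℤ → (Fin 2 → ℝ) → Fin 2 → ℂ` (Matsubara integer, continuum
  momentum, spin), continuous in the momentum, a bound `B` and a volume threshold `L₀` such that
  (i)  [UNIFORM BOUND] for `L ≥ L₀`, `M ≥ Mstar L`, every `(k, σ)`: `‖Σ̂_{L,M}(k, σ)‖ ≤ B`;
  (ii) [GRID CONVERGENCE] for every Matsubara integer `n`, spin `σ` and `ε > 0`, eventually in `L` and then eventually in `M`:
       `‖Σ̂_{L,M}((ω, k⃗), σ) − Σ∞ n p_{k⃗} σ‖ ≤ ε` for every frequency label `ω` with `matsubaraInt M ω = n` and every torus momentum `k⃗`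
       (`p_{k⃗} = latticeMomentum L k⃗`).

What child 4 does with it (its skeleton, `Lines/asm-repr`): (ii) + continuity ⇒ Riemann sums of `e^{ip(x−y)} ĝ_K(ω,p)² Σ∞` converge;
(i) + `|ĝ_K(ω,k⃗)|² ≤ ω⁻²` ⇒ dominated convergence over the Matsubara sum; the free part and the Matsubara-UV identification are
child 4's own.  Nothing is asserted here about the model: one definition with a body (type `VolLimitSlot = ℝ → ℝ → ℝ → TrigPolyC4v →
(ℕ → ℕ) → Prop` of the generic module).
-/

noncomputable section

namespace Summit.HubbardSuperconductivity.HubbardSuperconductivity.Theorems.KLRegimeSplit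

set_option linter.dupNamespace false -- summit = problem name (single-conjunct summit), D-0017

open Literature.MathematicalPhysics.QuantumLattice Literature.Probability.LatticeModels
open Summit.HubbardSuperconductivity.HubbardSuperconductivity.Theorems.KLProgrammeLegKernels

/-- **`FinalTwoLegVolLimit β U μ K Mstar`** — the termwise volume limit of the two-leg vertex function of the FULLY INTEGRATED
countertermed action of the frame `K` (scale index `nScales β + 1`): a momentum-continuous limit `Σ∞ n p σ` on `ℤ × ℝ² × Fin 2`, a
uniform bound `B` beyond `(L₀, Mstar)`, and, for every Matsubara integer `n`, convergence on the torus momentum grid, uniformly on the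
grid, eventually in `L` and then in `M`.  The text bound into the slot `VL` of `VolumeLimitP` / `TwoPointAssemblyP3`. -/
def FinalTwoLegVolLimit (β U μ : ℝ) (K : TrigPolyC4v) (Mstar : ℕ → ℕ) : Prop :=
  ∃ sigmaInf : ℤ → (Fin 2 → ℝ) → Fin 2 → ℂ, ∃ B : ℝ, ∃ L₀ : ℕ,
    (∀ (n : ℤ) (σ : Fin 2), Continuous fun p : Fin 2 → ℝ => sigmaInf n p σ) ∧
    (∀ (L : ℕ) [NeZero L], L₀ ≤ L → ∀ (M : ℕ) [NeZero M], Mstar L ≤ M →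
      ∀ (k : FreqMomentum L M) (σ : Fin 2), ‖klSelfEnergy L M β U μ K klE0 (nScales β + 1) k σ‖ ≤ B) ∧
    (∀ (n : ℤ) (σ : Fin 2) (ε : ℝ), 0 < ε → ∃ L₁ : ℕ, ∀ (L : ℕ) [NeZero L], L₁ ≤ L →
      ∃ M₁ : ℕ, ∀ (M : ℕ) [NeZero M], M₁ ≤ M → ∀ ω : MatsubaraIdx M, matsubaraInt M ω = n →
        ∀ k : TorusSite 2 L,
          ‖klSelfEnergy L M β U μ K klE0 (nScales β + 1) (ω, k) σ - sigmaInf n (latticeMomentum L k) σ‖ ≤ ε)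

/-- The last index of the extended ladder IS fully integrated: `Λ_{n_β+1} = e₀ 4^{-(n_β+1)} < π/β` (for `β > 0`). -/
theorem klScale_nScales_succ_lt {β : ℝ} (hβ : 0 < β) : klScale klE0 (nScales β + 1) < Real.pi / β := by
  unfold klScale nScales klTempScaleIdx
  have h4 : (1 : ℝ) < 4 := by norm_num
  have he : (0 : ℝ) < klE0 := by unfold klE0; norm_num
  set y : ℝ := Real.logb 4 (klE0 * β / Real.pi) with hy
  -- `y < ⌊y⌋₊ + 1`
  have hlt : y < (⌊y⌋₊ : ℕ) + 1 := Nat.lt_floor_add_one y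
  have hpow : klE0 * β / Real.pi < (4 : ℝ) ^ ((⌊y⌋₊ : ℕ) + 1) := by
    have hx : 0 < klE0 * β / Real.pi := by positivity
    have := Real.rpow_logb (by norm_num : (0:ℝ) < 4) (by norm_num : (4:ℝ) ≠ 1) hx
    rw [← hy] at this
    rw [← this, ← Real.rpow_natCast]
    exact Real.rpow_lt_rpow_of_exponent_lt h4 (by exact_mod_cast hlt)
  have h4pos : (0 : ℝ) < (4 : ℝ) ^ (⌊y⌋₊ + 1) := by positivity
  rw [div_lt_iff₀ Real.pi_pos] at hpow
  rw [lt_div_iff₀ hβ]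
  calc klE0 * ((4 : ℝ) ^ (⌊y⌋₊ + 1))⁻¹ * β = klE0 * β / (4 : ℝ) ^ (⌊y⌋₊ + 1) := by ring
    _ < Real.pi := by rw [div_lt_iff₀ h4pos]; linarith

/-- Hence the carrier child 4 reads, `klEffectiveAction … (nScales β + 1)`, is the fully integrated countertermed action
`effAction ℂ C^K V_K` (`hubbardEffectiveActionCT_eq_of_le`). -/
theorem klEffectiveAction_nScales_succ (L M : ℕ) [NeZero L] {β : ℝ} (hβ : 0 < β) (U μ : ℝ) (K : TrigPolyC4v) :
    klEffectiveAction L M β U μ K klE0 (nScales β + 1) =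
      effAction ℂ (hubbardCovarianceCT L M β μ 0 K) (hubbardInteractionCT L M β U K) := by
  have hpos : 0 < klScale klE0 (nScales β + 1) := by unfold klScale klE0; positivity
  rw [klEffectiveAction, hubbardEffectiveActionCT_eq_of_le L M β U μ 0 K hβ hpos (klScale_nScales_succ_lt hβ).le]

end Summit.HubbardSuperconductivity.HubbardSuperconductivity.Theorems.KLRegimeSplit

end
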